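import Mathlib
import Summits.Ventures.PercRepro2.HCov
import Summits.Ventures.PercRepro2.RootLeafUSigns
import Summits.Ventures.PercRepro2.RootLeafUCore
import Summits.Ventures.PercRepro2.RootLeafUOu
import Summits.Ventures.PercRepro2.RootLeafUHalf

/-!
# (G4-u): the `o ∈ L` half `T2oL` as the L-exploration mirror of `T2oK` — the mixed covariance form
(blind cell PercRepro2, p4 g13; S3 v55/v56 item (aa); no definitions, every mass written out)

Conventions of RootLeafUHalf (`L = C(u)`, `K = C(a₂)`, `R = {u ↮ a₂, u ↮ c} = PD ⊔ T`, `W = P(R) = D + t`,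
`Y = P(R, oL) = Y_N + Y_t`, `M = P(T, oL, bL)`, `B₁ = P(T, bL)`, `Y_{bK} = P(R, oL, bK)`, `P(R, bK)`;
`α, β, κ` the constants of RootLeafUHalf, `B = α − κ ≤ 0` (`B_nonpos`), `(OU) = T2oL(o := u) ≥ 0`
(`T2oL_root_nonneg`, the o-free core of RootLeafUOu)).

**The mirror identity** (`W_mul_T2oL_eq`, a ring identity after `connEvent u u = univ`):

  `W·T2oL = B·(Y_t·W − t·Y) + 2β·[(M·W − B₁·Y) − (Y_{bK}·W − P(R,bK)·Y)] + (OU)·Y`,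

i.e. `T2oL = W·Cov_R(Φ_L, 1_{oL}) + (OU)·P(oL | R)` with `Φ_L = A + B·1_{cK} + 2β(1_{bL}1_{cK} − 1_{bK})`
(the exploration functional of S3 (m)): `B·(Y_t·W − t·Y) = |B|·δ_o ≥ 0` (`ToL_mul_D_le`, BHK06 1.4),
`P(R,bK)·Y − Y_{bK}·W ≥ 0` (`YbK_mul_W_le`: `bhk_cross_cluster_avoid` at `(u, a₂)` avoiding `{a₂, c}`,
`o ∈ L` against `b ∈ K`), `(OU)·Y ≥ 0`, and the ONLY unsigned term is the mixed covariance
`2β·(M·W − B₁·Y) = 2β·W²·Cov_R(1_{b∈L}·1_{c∈K}, 1_{o∈L})` — the exact mirror of the `o ∈ K` half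
(RootLeafUMixK: `P₀·T2oK = A·ℋ′ + 2β·X_b + ℰ·(e0P₀ − d0P_o)`, the unsigned term
`2β·P₀²·Cov'(1_{c∈L}·1_{b∈K} − 1_{b∈L}, 1_{o∈K})`).  Hence **`T2oL_nonneg_of_mixL`**: the single
inequality (MIX-L) `2β·(B₁·Y − M·W) ≤ |B|·δ_o + 2β·(P(R,bK)·Y − Y_{bK}·W) + (OU)·Y` implies
`0 ≤ T2oL`; on the tie class `M = 0` it reads `2β·B₁·Y ≤ |B|·δ_o + 2β·(P(R,bK)·Y − Y_{bK}·W) + (OU)·Y`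
(W1's `o ∈ L` obligation in yet another exact form).  Census (own code): unlike the `o ∈ K` side, the
`(OU)`-free version `Cov_R(Φ_L, 1_{oL}) ≥ 0` FAILS (1–4 / 120 per palette, using up to 89 % of the
`(OU)·Y` payer) — the o-free core is load-bearing on this side.
-/

namespace Summit.Ventures.PercRepro2

open UnionCluster CovForm

namespace RootLeafU

namespace MixL

variable {V : Type*} {E : Type*} [Fintype E] [DecidableEq E] [Fintype V] [DecidableEq V]
  {R : Type*} [Field R] [LinearOrder R] [IsStrictOrderedRing R]

section Identity

variable (p : E → R) (ends : E → Sym2 V) (o a₂ c b u : V)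

omit [Fintype V] [DecidableEq V] [LinearOrder R] [IsStrictOrderedRing R] in
/-- **The mirror identity**: `W·T2oL = B·(Y_t·W − t·Y) + 2β·[(M·W − B₁·Y) − (Y_bK·W − P(R,bK)·Y)] + (OU)·Y`
with `W = D + t`, `Y = Y_N + Y_t`, `(OU) = T2oL(o := u)`. -/
theorem W_mul_T2oL_eq :
    (prob p (PDEvent ends u a₂ c) + prob p (TEvent ends u a₂ c)) * T2oL p ends o a₂ c b u =
      ((prob p (PDEvent ends u a₂ c) * prob p (connEvent ends a₂ b) + prob p (avoidAll ends a₂ {c}) * gap p ends u a₂ b) - (prob p Set.univ * EQb3 p ends u a₂ c b + prob p Set.univ * PDb p ends u a₂ c b + prob p (connEvent ends a₂ b) * EQ3 p ends u a₂ c + prob p (connEvent ends a₂ b) * prob p (avoidAll ends a₂ {u}) - (prob p Set.univ - prob p (avoidAll ends a₂ {c})) * gap p ends u a₂ b)) * (prob p (TEvent ends u a₂ c ∩ connEvent ends u o) * (prob p (PDEvent ends u a₂ c) + prob p (TEvent ends u a₂ c)) - prob p (TEvent ends u a₂ c) * (prob p (PDEvent ends u a₂ c ∩ connEvent ends u o)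 + prob p (TEvent ends u a₂ c ∩ connEvent ends u o))) +
        2 * (prob p Set.univ * prob p (PDEvent ends u a₂ c) + prob p (avoidAll ends a₂ {c}) * prob p (avoidAll ends a₂ {u})) * ((prob p (TEvent ends u a₂ c ∩ (connEvent ends u o ∩ connEvent ends u b)) * (prob p (PDEvent ends u a₂ c) + prob p (TEvent ends u a₂ c)) - prob p (TEvent ends u a₂ c ∩ connEvent ends u b) * (prob p (PDEvent ends u a₂ c ∩ connEvent ends u o) + prob p (TEvent ends u a₂ c ∩ connEvent ends u o))) - ((prob p (PDEvent ends u a₂ c ∩ (connEvent ends u o ∩ connEvent ends a₂ b)) + prob p (TEvent ends u a₂ c ∩ (connEvent ends u o ∩ connEvent ends a₂ b))) * (prob p (PDEvent ends u a₂ c) + prob p (TEvent ends u a₂ c)) - (prob p (PDEvent ends u a₂ c ∩ connEvent ends a₂ b) + prob p (TEvent ends u a₂ c ∩ connEvent ends a₂ b)) * (prob p (PDEvent ends u a₂ c ∩ connEvent ends u o) + prob p (TEvent ends u a₂ c ∩ connEvent ends u o)))) +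
        T2oL p ends u a₂ c b u * (prob p (PDEvent ends u a₂ c ∩ connEvent ends u o) + prob p (TEvent ends u a₂ c ∩ connEvent ends u o)) := by
  unfold T2oL
  simp only [connEvent_self, Set.inter_univ, Set.univ_inter]
  ring

end Identity

section Signs

variable (p : E → R) (ends : E → Sym2 V) (o a₂ c b u : V)

/-- **BHK06 Thm 1.4 at `(u, a₂)` avoiding `{a₂, c}`**: `Y_bK·W ≤ P(R,bK)·Y` (`o ∈ L` against `b ∈ K`),
in `PD`/`T` masses. -/
theorem YbK_mul_W_le (hp : IsProbVec p) :
    (prob p (PDEvent ends u a₂ c ∩ (connEvent ends u o ∩ connEvent ends a₂ b)) + prob p (TEvent ends u a₂ c ∩ (connEvent ends u o ∩ connEvent ends a₂ b))) * (prob p (PDEvent ends u a₂ c) + prob p (TEvent ends u a₂ c)) ≤ (prob p (PDEvent ends u a₂ c ∩ connEvent ends a₂ b) + prob p (TEvent ends u a₂ c ∩ connEvent ends a₂ b)) * (prob p (PDEvent ends u a₂ c ∩ connEvent ends u o) + prob p (TEvent ends u a₂ c ∩ connEvent ends u o)) := by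
  classical
  have hU : IsUpperSet ({W : Set V | o ∈ W}) := fun _ _ h ho => h ho
  have hV : IsUpperSet ({W : Set V | b ∈ W}) := fun _ _ h hb => h hb
  have ha2 : a₂ ∈ ({a₂, c} : Finset V) := by simp
  have f5 := bhk_cross_cluster_avoid p hp ends u a₂ ha2 hU hV
  rw [ExploreA3.clusterInEvent_mem_eq, ExploreA3.clusterInEvent_mem_eq] at f5
  have e5a : connEvent ends u o ∩ connEvent ends a₂ b ∩ avoidAll ends u {a₂, c} =
      avoidAll ends u {a₂, c} ∩ (connEvent ends u o ∩ connEvent ends a₂ b) := Set.inter_comm _ _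
  have e5b : connEvent ends u o ∩ avoidAll ends u {a₂, c} =
      avoidAll ends u {a₂, c} ∩ connEvent ends u o := Set.inter_comm _ _
  have e5c : connEvent ends a₂ b ∩ avoidAll ends u {a₂, c} =
      avoidAll ends u {a₂, c} ∩ connEvent ends a₂ b := Set.inter_comm _ _
  rw [e5a, e5b, e5c] at f5
  have hW := ISplit.prob_PD_add_T p ends u a₂ c Set.univ
  simp only [Set.inter_univ] at hW
  have hY := ISplit.prob_PD_add_T p ends u a₂ c (connEvent ends u o)
  have hYbK := ISplit.prob_PD_add_T p ends u a₂ c (connEvent ends u o ∩ connEvent ends a₂ b)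
  have hRbK := ISplit.prob_PD_add_T p ends u a₂ c (connEvent ends a₂ b)
  rw [hW, hY, hYbK, hRbK]
  linarith [f5]

end Signs

section Reduction

variable (p : E → R) (ends : E → Sym2 V) (o a₂ c b u : V)

omit [Fintype V] [DecidableEq V] in
/-- **`0 ≤ T2oL` from (MIX-L)**: `0 ≤ B·(Y_t·W − t·Y) + 2β·[(M·W − B₁·Y) − (Y_bK·W − P(R,bK)·Y)] + (OU)·Y`
(the mixed-covariance bound; the other three terms are signed: `|B|·δ_o ≥ 0`, `P(R,bK)·Y − Y_bK·W ≥ 0`,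
`(OU)·Y ≥ 0`) implies the `o ∈ L` half of W1 = `0 ≤ T2`. -/
theorem T2oL_nonneg_of_mixL (hp : IsProbVec p)
    (hmix : 0 ≤ ((prob p (PDEvent ends u a₂ c) * prob p (connEvent ends a₂ b) + prob p (avoidAll ends a₂ {c}) * gap p ends u a₂ b) - (prob p Set.univ * EQb3 p ends u a₂ c b + prob p Set.univ * PDb p ends u a₂ c b + prob p (connEvent ends a₂ b) * EQ3 p ends u a₂ c + prob p (connEvent ends a₂ b) * prob p (avoidAll ends a₂ {u}) - (prob p Set.univ - prob p (avoidAll ends a₂ {c})) * gap p ends u a₂ b)) * (prob p (TEvent ends u a₂ c ∩ connEvent ends u o) * (prob p (PDEvent ends u a₂ c) + prob p (TEvent ends u a₂ c)) - prob p (TEvent ends u a₂ c) * (prob p (PDEvent ends u a₂ c ∩ connEvent ends u o) + prob p (TEvent ends u a₂ c ∩ connEvent ends u o))) +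
        2 * (prob p Set.univ * prob p (PDEvent ends u a₂ c) + prob p (avoidAll ends a₂ {c}) * prob p (avoidAll ends a₂ {u})) * ((prob p (TEvent ends u a₂ c ∩ (connEvent ends u o ∩ connEvent ends u b)) * (prob p (PDEvent ends u a₂ c) + prob p (TEvent ends u a₂ c)) - prob p (TEvent ends u a₂ c ∩ connEvent ends u b) * (prob p (PDEvent ends u a₂ c ∩ connEvent ends u o) + prob p (TEvent ends u a₂ c ∩ connEvent ends u o))) - ((prob p (PDEvent ends u a₂ c ∩ (connEvent ends u o ∩ connEvent ends a₂ b)) + prob p (TEvent ends u a₂ c ∩ (connEvent ends u o ∩ connEvent ends a₂ b))) * (prob p (PDEvent ends u a₂ c) + prob p (TEvent ends u a₂ c)) - (prob p (PDEvent ends u a₂ c ∩ connEvent ends a₂ b) + prob p (TEvent ends u a₂ c ∩ connEvent ends a₂ b)) * (prob p (PDEvent ends u a₂ c ∩ connEvent ends u o) + prob p (TEvent ends u a₂ c ∩ connEvent ends u o)))) +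
        T2oL p ends u a₂ c b u * (prob p (PDEvent ends u a₂ c ∩ connEvent ends u o) + prob p (TEvent ends u a₂ c ∩ connEvent ends u o))) :
    0 ≤ T2oL p ends o a₂ c b u := by
  have hid := W_mul_T2oL_eq p ends o a₂ c b u
  have hW : 0 ≤ (prob p (PDEvent ends u a₂ c) + prob p (TEvent ends u a₂ c)) := add_nonneg (prob_nonneg hp _) (prob_nonneg hp _)
  rcases hW.lt_or_eq with hpos | hzero
  · have h : 0 ≤ (prob p (PDEvent ends u a₂ c) + prob p (TEvent ends u a₂ c)) * T2oL p ends o a₂ c b u := by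
      rw [hid]
      exact hmix
    rcases lt_or_ge (T2oL p ends o a₂ c b u) 0 with hneg | hge
    · have := mul_neg_of_pos_of_neg hpos hneg
      linarith
    · exact hge
  · -- `W = 0`: every `PD`/`T` mass vanishes and `T2oL = 0`
    have hz := hzero.symm
    have hD := prob_nonneg hp (PDEvent ends u a₂ c)
    have hT := prob_nonneg hp (TEvent ends u a₂ c)
    have z : ∀ X : Set (Config E), prob p (PDEvent ends u a₂ c ∩ X) = 0 ∧ prob p (TEvent ends u a₂ c ∩ X) = 0 := by
      intro X
      have hDX := prob_inter_le_left hp (PDEvent ends u a₂ c) X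
      have hTX := prob_inter_le_left hp (TEvent ends u a₂ c) X
      have hDX0 := prob_nonneg hp (PDEvent ends u a₂ c ∩ X)
      have hTX0 := prob_nonneg hp (TEvent ends u a₂ c ∩ X)
      constructor <;> linarith
    unfold T2oL
    rw [(z (connEvent ends u o)).1, (z (connEvent ends u o)).2,
      (z (connEvent ends u o ∩ connEvent ends u b)).2,
      (z (connEvent ends u o ∩ connEvent ends a₂ b)).1, (z (connEvent ends u o ∩ connEvent ends a₂ b)).2]
    simp

end Reduction

end MixL

end RootLeafU

end Summit.Ventures.PercRepro2
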